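import Summits.QuantumFields.YangMills.Theorems.BalabanLadderIRColdDoublingRecursionSC
import Summits.QuantumFields.YangMills.Theorems.BalabanLadderIRPinnedExit96
import Summits.QuantumFields.YangMills.Theorems.BalabanLadderIRTwistCostOfPurity
import Literature.MathematicalPhysics.QuantumFieldTheory.WilsonFinTorusTwistedPartition
import Literature.MathematicalPhysics.QuantumLattice.GaugeGroupsProofs
import Literature.MathematicalPhysics.QuantumLattice.RepLieAlgebraUnitary
import HarnessLib

/-!
# Heavy temporal twist ⇒ eventual ½-impurity of every fixed cold box ⇒ the β-UNIFORM exit form of the seed is false (CORE file, 1 of 3)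

Landable of the crux line `Cruxes/IR/Lines/heavy_twist.lean` (ym-ir-idea-10, lens «negation»; critic of record ym-ir-crit-3, verdict PASS-AS-WALL;
landing co-signed 2026-08-28T07:57:59Z), split into three files under the 400-line cap: THIS core file (§0–§3 + the S2-only corollaries),
`UniformExitFalseOfHeavyTwistWindow.lean` (RUNG 2: the deconfinement twist window ⇒ linear selector growth ⇒ `¬ UniformExit24`, parity-free),
`UniformExitFalseOfHeavyTwistExtras.lean` (PX-squeeze, RUNG 3 typed, the SU(2) twist eater).

MECHANISM ('t Hooft electric/magnetic ℤ₂ duality read backwards, at FIXED lattice box).  For a lattice representation `r` of a compact group `G`, a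
CENTRAL element `c` and a direction `μ`, the twisted cold box `twistedColdZ r.ρ β (update 1 μ c) L t` is the Literature object
`wilsonFinTorusTwistedPartition` ('t Hooft twist `c` in the `(0, μ)` plaquettes through one line).  §1–§2: the purity defect of the cold `4:1` box
dominates half the twist cost, `(1 − ẑ)/2 ≤ δᶜ_β(L)` with `ẑ = twistRatio r c μ β L` — PROVED for every central twist from the tree theorem
`Cruxes.IR.TwistCost.half_twist_cost_le_coldDefect` (ym-ir-idea-9) — so a HEAVY twist (`ẑ → 0` as `β → ∞` at fixed `L`, the Prop `HeavyTwistAt`)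
forces eventual ½-impurity of every fixed box and refutes the β-uniform exit form `UniformExitAtRep r θ` for every `θ < 1/2`.  §3: the class level
`G = SU(2)`, `c = −1`: `PurityTwistBoundSU2` is a THEOREM (`purityTwistBoundSU2_holds`); `HeavyTwistSU2` (S2) is the line's one physical input, NOT
proved here (finite-dimensional Laplace asymptotics around the rigid twist-eating flat connections; no engine in the tree); `UniformExitAt θ` /
`UniformExit24` are the refuted-mod-S2 quantifier swaps of the seed `BasinRung.ColdExitAt` (`coldExitAt_of_uniformExitAt`).

HONEST FRAMING: a NEGATIVE / wall theorem about the seed functional of the IR leaf; it proves NOTHING toward `BalabanLadder.IR` (stmt-QuantumFields-19354) or `IRcof`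
(stmt-QuantumFields-26930), whose count stays 0/1; the Yang–Mills mass gap (Clay) is NOT proved anywhere in this tree; R4 closes only the conditional finite-𝕋⁴ rung `BalabanLadder.UV`.
-/

set_option autoImplicit false

noncomputable section

open Filter Topology MeasureTheory
open Literature.MathematicalPhysics.QuantumFieldTheory Literature.MathematicalPhysics.QuantumLattice
open Summit.QuantumFields.YangMills.Cruxes.IR.ColdPurityBridge (coldDefect)
open Summit.QuantumFields.YangMills.Cruxes.IR.ColdPressurePincer (AFToColdPressure IRnsc)
open Summit.QuantumFields.YangMills.Cruxes.IR.BasinRung (ColdExitAt basin_step24)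
open Summit.QuantumFields.YangMills.Cruxes.IR.AspectBootstrap (boxDefect coldDefect_eq_boxDefect axisSymmetric tracePositive)
open Summit.QuantumFields.YangMills.Cruxes.IR.PinnedExit96 (PinnedExitAt)
open Summit.QuantumFields.YangMills.Cruxes.OSLegsFromFemtoAndGap.DlrCollarTransfer (LowerBounds)

namespace Summit.QuantumFields.YangMills.Theorems.ColdExitSC.Negative.HeavyTwist

/-! ## §0 The twisted cold box — since rev 4 BY DEFINITION the Literature object `wilsonFinTorusTwistedPartition ρ β z L L L t`
(lit-4 p611125, `Literature/MathematicalPhysics/QuantumFieldTheory/WilsonFinTorusTwistedPartition.lean`; its `tHooftTwistFactor` is this line's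
`twistFactor` verbatim), so that S1 is DISCHARGED BY NAME (rev 5, `purityTwistBoundAt_of_central`) from idea-9 g3's landed `TwistCost.half_twist_cost_le_coldDefect` (p613382);
rev ≤ 3 and line `flux-purity-split` carried the same integral verbatim (`twistedColdZ_eq_integral` is `rfl`). -/

section Defs

variable {G : Type} [Group G]

/-- The four coordinates of a site of the `Fin`-torus, as naturals. [verbatim `FluxPuritySplit.siteCoord` = Literature `finTorusSiteCoord`] -/
def siteCoord {n₀ n₁ n₂ n₃ : ℕ} (x : FinTorusSite n₀ n₁ n₂ n₃) : Fin 4 → ℕ :=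
  ![(x.1 : ℕ), (x.2.1 : ℕ), (x.2.2.1 : ℕ), (x.2.2.2 : ℕ)]

/-- 't Hooft's temporal twist insertion: the plaquette at `x` with orientation `(μ, ν)` is multiplied by `z μ` iff `ν = 3` (the short,
thermal direction of the cold box), `x₃ = 0` and `x_μ = 0`. [verbatim `FluxPuritySplit.twistFactor`; 't Hooft 1979 §2; Greensite 2011 (4.43)] -/
def twistFactor (z : Fin 4 → G) {n₀ n₁ n₂ n₃ : ℕ} (x : FinTorusSite n₀ n₁ n₂ n₃) (μ ν : Fin 4) : G :=
  if ν = 3 ∧ siteCoord x 3 = 0 ∧ siteCoord x μ = 0 then z μ else 1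

/-- The trivial twist `z = 1` changes no plaquette weight: `twistFactor 1 x μ ν = 1`. -/
@[simp] theorem twistFactor_one {n₀ n₁ n₂ n₃ : ℕ} (x : FinTorusSite n₀ n₁ n₂ n₃) (μ ν : Fin 4) :
    twistFactor (1 : Fin 4 → G) x μ ν = 1 := by
  unfold twistFactor
  split <;> simp

/-- The line's twist factor IS the Literature one (definitional). -/
theorem twistFactor_eq_tHooft (z : Fin 4 → G) {n₀ n₁ n₂ n₃ : ℕ} (x : FinTorusSite n₀ n₁ n₂ n₃) (μ ν : Fin 4) :
    twistFactor z x μ ν = tHooftTwistFactor z x μ ν := rfl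

variable {n : ℕ} (ρ : G →* Matrix (Fin n) (Fin n) ℂ) [TopologicalSpace G] [IsTopologicalGroup G] [CompactSpace G]
  [MeasurableSpace G] [BorelSpace G]

/-- The temporally twisted Wilson partition function of the cold box `L × L × L × t` := the Literature
`wilsonFinTorusTwistedPartition ρ β z L L L t` ('t Hooft's `W{k, m = 0}`, Greensite (4.44)). -/
def twistedColdZ (β : ℝ) (z : Fin 4 → G) (L t : ℕ) : ℝ :=
  wilsonFinTorusTwistedPartition ρ β z L L L t

/-- `rfl`-bridge to the Literature name (for citing S1-type theorems stated over `wilsonFinTorusTwistedPartition`). -/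
theorem twistedColdZ_eq (β : ℝ) (z : Fin 4 → G) (L t : ℕ) :
    twistedColdZ ρ β z L t = wilsonFinTorusTwistedPartition ρ β z L L L t := rfl

/-- Continuity with rev ≤ 3 / line `flux-purity-split` (the verbatim integral; definitional). -/
theorem twistedColdZ_eq_integral (β : ℝ) (z : Fin 4 → G) (L t : ℕ) :
    twistedColdZ ρ β z L t =
      ∫ U, Real.exp (-β * ∑ x : FinTorusSite L L L t, ∑ q : {q : Fin 4 × Fin 4 // q.1 < q.2},
        ((n : ℝ) - (ρ (twistFactor z x q.1.1 q.1.2 * finTorusPlaquette U x q.1.1 q.1.2)).trace.re))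
      ∂(Measure.pi fun _ : FinTorusSite L L L t × Fin 4 => haarProbability G) := rfl

/-- No twist is the Wilson partition function. -/
theorem twistedColdZ_one (β : ℝ) (L t : ℕ) :
    twistedColdZ ρ β (1 : Fin 4 → G) L t = wilsonFinTorusPartition ρ β L L L t := by
  rw [twistedColdZ, wilsonFinTorusTwistedPartition_one]

end Defs

/-! ## §1 The two-sector inequality (PROVED, pure real algebra): purity defect ≥ (1 − r²)/2 ≥ (1 − r)/2 -/

/-- **Two centre sectors force impurity** (PROVED).  If the thermal traces split as `Z(t) = Z₊ + Z₋`, `Z⁻(t) = Z₊ − Z₋` (twisted trace),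
`Z(2t) = Z₊' + Z₋'` with `Z_± ≥ 0` and the per-sector trace-positivity `Z_±' ≤ Z_±²` (`Σ μᵢ² ≤ (Σ μᵢ)²` for the non-negative eigenvalues of
`𝕋^t` in each sector), then the period-doubling defect is at least `(1 − r²)/2`, `r = Z⁻(t)/Z(t)`:  `2(Z₊² + Z₋²) = Z² + (Z⁻)²`. -/
theorem defect_ge_of_sectors (Zp Zm Z2p Z2m : ℝ) (hZ : 0 < Zp + Zm)
    (h2p : Z2p ≤ Zp ^ 2) (h2m : Z2m ≤ Zm ^ 2) :
    (1 - ((Zp - Zm) / (Zp + Zm)) ^ 2) / 2 ≤ 1 - (Z2p + Z2m) / (Zp + Zm) ^ 2 := by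
  have hZ2 : 0 < (Zp + Zm) ^ 2 := by positivity
  have hZne : Zp + Zm ≠ 0 := hZ.ne'
  have h1 : (Z2p + Z2m) / (Zp + Zm) ^ 2 ≤ (Zp ^ 2 + Zm ^ 2) / (Zp + Zm) ^ 2 :=
    div_le_div_of_nonneg_right (by linarith) hZ2.le
  have h2 : (Zp ^ 2 + Zm ^ 2) / (Zp + Zm) ^ 2 = (1 + ((Zp - Zm) / (Zp + Zm)) ^ 2) / 2 := by
    rw [div_pow]
    field_simp
    ring
  linarith [h1, h2.le, h2.ge]

/-- The `(1 − r)/2` form used below follows for `0 ≤ r ≤ 1` (twisted ≤ untwisted, both positive). -/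
theorem half_sub_le_of_sq {r : ℝ} (hr0 : 0 ≤ r) (hr1 : r ≤ 1) : (1 - r) / 2 ≤ (1 - r ^ 2) / 2 := by
  nlinarith

/-! ## §2 Model layer at `(G, r, c, μ)`: the twist ratio, the two inputs, and eventual ½-impurity (PROVED from them) -/

section Model

variable {G : Type} [Group G] [TopologicalSpace G] [IsTopologicalGroup G] [CompactSpace G]
  [MeasurableSpace G] [BorelSpace G]

/-- **The twist ratio of the cold box** `r = Z^{(c)}_β(L³×⌊L/4⌋) / Z_β(L³×⌊L/4⌋)`, twist `c` in the `(μ,3)`-planes only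
(`e^{−F_mg}`, Greensite (4.44); `Z_k(1)` of de Forcrand–von Smekal for `G = SU(2)`, `c = −1`). -/
def twistRatio (r : LatticeRep G) (c : G) (μ : Fin 4) (β : ℝ) (L : ℕ) : ℝ :=
  twistedColdZ r.ρ β (Function.update 1 μ c) L (L / 4) / wilsonFinTorusPartition r.ρ β L L L (L / 4)

/-- Sanity (PROVED): the trivial twist has ratio `1` at every `(β, L)` — so `HeavyTwistAt r 1 μ` is FALSE; S2 genuinely uses `c ≠ 1`. -/
theorem twistRatio_one (r : LatticeRep G) (μ : Fin 4) (β : ℝ) (L : ℕ) : twistRatio r 1 μ β L = 1 := by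
  haveI : SecondCountableTopology G :=
    (r.continuous.isClosedEmbedding r.injective).isEmbedding.secondCountableTopology
  have h1 : Function.update (1 : Fin 4 → G) μ 1 = 1 := by
    simp
  rw [twistRatio, h1, twistedColdZ_one]
  exact div_self (wilsonFinTorusPartition_pos r.continuous β L L L (L / 4)).ne'

/-- **S1 at `(G, r, c, μ)` — purity defect ≥ half the twist cost:** `(1 − r_β(L))/2 ≤ δᶜ_β(L)` for `β ≥ 0`, `L ≥ 8`.  For central `c` with
`c² = 1` this is the two-sector algebra of §1 / idea-9's `FluxPurity.twist_cost_le_of_pure_real` with `θ := δᶜ` (abstractly PROVED there;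
Wilson-side discharge located there).  Route-posited per-rep predicate. -/
def PurityTwistBoundAt (r : LatticeRep G) (c : G) (μ : Fin 4) : Prop :=
  ∀ β : ℝ, 0 ≤ β → ∀ L : ℕ, 8 ≤ L → (1 - twistRatio r c μ β L) / 2 ≤ coldDefect r.ρ β L

/-- **S2 at `(G, r, c, μ)` — the twist is heavy in the femto regime:** at every fixed lattice box `L ≥ 8`, `r_β(L) → 0` as `β → ∞`
(electric flux free; deconfined side of 't Hooft's duality).  Route-posited per-rep predicate; for `SU(2)`, `c = −1`: finite-dimensional
Laplace asymptotics with critical dimensions `dim 𝒢` (twisted: 4 isolated rigid orbits) vs `dim 𝒢 + 3` (untwisted abelian family), `r = O(β^{−3/2})`. -/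
def HeavyTwistAt (r : LatticeRep G) (c : G) (μ : Fin 4) : Prop :=
  ∀ L : ℕ, 8 ≤ L → Tendsto (fun β : ℝ => twistRatio r c μ β L) atTop (𝓝 0)

/-- The trivial centre element is never a heavy twist (`twistRatio r 1 μ β L = 1` does not tend to `0`). -/
theorem not_heavyTwistAt_one (r : LatticeRep G) (μ : Fin 4) : ¬ HeavyTwistAt r 1 μ := by
  intro h
  have h8 := h 8 le_rfl
  simp only [twistRatio_one] at h8
  have := tendsto_nhds_unique h8 tendsto_const_nhds
  norm_num at this

/-- `E` with the box chosen BEFORE the coupling, at `(G, r)`. [verbatim `FemtoWall.UniformExitAtRep`] -/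
def UniformExitAtRep (r : LatticeRep G) (θ : ℝ) : Prop :=
  ∃ L : ℕ, 8 ≤ L ∧ ∃ β₁ : ℝ, ∀ β : ℝ, β₁ ≤ β → coldDefect r.ρ β L ≤ θ

/-- Eventual `θ`-impurity of every fixed box at `(G, r)`. [verbatim `FemtoWall.EventualImpurityAt`] -/
def EventualImpurityAt (r : LatticeRep G) (θ : ℝ) : Prop :=
  ∀ L : ℕ, 8 ≤ L → ∀ᶠ β : ℝ in atTop, θ < coldDefect r.ρ β L

/-- No β-uniform witness from eventual impurity. [verbatim `FemtoWall.not_uniformExitAtRep`] -/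
theorem not_uniformExitAtRep (r : LatticeRep G) {θ : ℝ} (hI : EventualImpurityAt r θ) :
    ¬ UniformExitAtRep r θ := by
  rintro ⟨L, hL, β₁, h⟩
  obtain ⟨β, hβ, hβ₁⟩ := ((hI L hL).and (eventually_ge_atTop β₁)).exists
  exact absurd (h β hβ₁) (not_le.mpr hβ)

/-- **S1 ∧ S2 ⇒ eventual `θ`-impurity of every fixed box for every `θ < 1/2`** (PROVED): `δᶜ ≥ (1 − r)/2 → 1/2`. -/
theorem eventualImpurityAt_of_heavyTwist (r : LatticeRep G) {c : G} {μ : Fin 4}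
    (hB : PurityTwistBoundAt r c μ) (hH : HeavyTwistAt r c μ) {θ : ℝ} (hθ : θ < 1 / 2) :
    EventualImpurityAt r θ := by
  intro L hL
  have h1 : Tendsto (fun β : ℝ => (1 - twistRatio r c μ β L) / 2) atTop (𝓝 ((1 - 0) / 2)) :=
    (tendsto_const_nhds.sub (hH L hL)).div_const 2
  have h2 : θ < (1 - 0) / 2 := by linarith
  filter_upwards [h1.eventually (Ioi_mem_nhds h2), eventually_ge_atTop (0 : ℝ)] with β hβ hβ0
  exact lt_of_lt_of_le hβ (hB β hβ0 L hL)

/-- Hence (PROVED): S1 ∧ S2 at `(G, r)` refute every β-uniform witness at tolerance `θ < 1/2`. -/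
theorem not_uniformExitAtRep_of_heavyTwist (r : LatticeRep G) {c : G} {μ : Fin 4}
    (hB : PurityTwistBoundAt r c μ) (hH : HeavyTwistAt r c μ) {θ : ℝ} (hθ : θ < 1 / 2) :
    ¬ UniformExitAtRep r θ :=
  not_uniformExitAtRep r (eventualImpurityAt_of_heavyTwist r hB hH hθ)

/-- **S1 DISCHARGED (rev 5) — for EVERY compact `G`, every lattice rep `r`, every CENTRAL twist `c`, every direction `μ`:**
`PurityTwistBoundAt r c μ` holds.  Proof: idea-9 g3's landed `TwistCost.half_twist_cost_le_coldDefect` (p613382,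
`Theorems/BalabanLadderIRTwistCostOfPurity.lean`: `(1 − Z^{(z)}/Z)/2 ≤ δᶜ` on the cold box for central `z : Fin 4 → G`, `β ≥ 0`, `L ≥ 8`),
instantiated at `z := update 1 μ c`; `twistRatio` / `twistedColdZ` ARE the Literature objects since rev 4 (definitional unfolding, no rewriting).
CREDIT: idea-9 (abstract seam + Theorems-lane discharge), lit-4 (p611125/p611637 Literature twisted partition function & trace formula). -/
theorem purityTwistBoundAt_of_central (r : LatticeRep G) {c : G} (hc : c ∈ Subgroup.center G) (μ : Fin 4) :
    PurityTwistBoundAt r c μ := by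
  intro β hβ L hL
  haveI : SecondCountableTopology G :=
    (r.continuous.isClosedEmbedding r.injective).isEmbedding.secondCountableTopology
  have hz : ∀ ν, Function.update (1 : Fin 4 → G) μ c ν ∈ Subgroup.center G := by
    intro ν
    by_cases h : ν = μ
    · subst h
      simpa using hc
    · simp [Function.update_of_ne h]
  show (1 - wilsonFinTorusTwistedPartition r.ρ β (Function.update 1 μ c) L L L (L / 4) /
      wilsonFinTorusPartition r.ρ β L L L (L / 4)) / 2 ≤ coldDefect r.ρ β L
  exact (Summit.QuantumFields.YangMills.Cruxes.IR.TwistCost.half_twist_cost_le_coldDefect r.continuous r.mem_unitary hβ hL hz).1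

/-- Hence (PROVED, rev 5): for a central heavy twist, S2 ALONE refutes every β-uniform witness at tolerance `θ < 1/2`. -/
theorem not_uniformExitAtRep_of_heavyTwist_central (r : LatticeRep G) {c : G} (hc : c ∈ Subgroup.center G) {μ : Fin 4}
    (hH : HeavyTwistAt r c μ) {θ : ℝ} (hθ : θ < 1 / 2) : ¬ UniformExitAtRep r θ :=
  not_uniformExitAtRep_of_heavyTwist r (purityTwistBoundAt_of_central r hc μ) hH hθ

end Model

/-! ## §3 Class level `SU(2)`, twist `c = −1` in the `(0,3)`-planes: the two stubs' Props, ½-impurity, the refuted strengthening -/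

/-- The non-trivial centre element `−1 ∈ SU(2)` (diagonal with entries `−1`; `‖−1‖ = 1`, `(−1)·(−1) = 1`). -/
def minusOneSU2 : Matrix.specialUnitaryGroup (Fin 2) ℂ :=
  ⟨Matrix.diagonal fun _ => (-1 : ℂ), (diagonal_mem_specialUnitaryGroup_iff _).2 ⟨fun _ => by simp, by simp⟩⟩

/-- As a matrix, `minusOneSU2 = −1`. -/
theorem coe_minusOneSU2 : ((minusOneSU2 : Matrix.specialUnitaryGroup (Fin 2) ℂ) : Matrix (Fin 2) (Fin 2) ℂ) = -1 := by
  change Matrix.diagonal (fun _ => (-1 : ℂ)) = -1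
  rw [← Matrix.diagonal_one, Matrix.diagonal_neg]

/-- `−1` is CENTRAL in `SU(2)` (it is scalar) — the hypothesis under which idea-9's twist-cost theorem applies (rev 5). -/
theorem minusOneSU2_mem_center : minusOneSU2 ∈ Subgroup.center (Matrix.specialUnitaryGroup (Fin 2) ℂ) := by
  rw [Subgroup.mem_center_iff]
  intro g
  apply Subtype.ext
  change (g : Matrix (Fin 2) (Fin 2) ℂ) * (minusOneSU2 : Matrix (Fin 2) (Fin 2) ℂ) =
    (minusOneSU2 : Matrix (Fin 2) (Fin 2) ℂ) * (g : Matrix (Fin 2) (Fin 2) ℂ)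
  rw [coe_minusOneSU2, mul_neg_one, neg_one_mul]

/-- **S1 `PurityTwistBoundSU2` (a STUB until rev 4; a THEOREM since rev 5: `purityTwistBoundSU2_holds`)** — purity defect ≥ half the `ℤ₂` twist cost, `SU(2)` fundamental Wilson action, twist `−1` in the
`(0,3)`-planes: `(1 − r_β(L))/2 ≤ δᶜ_β(L)` (`β ≥ 0`, `L ≥ 8`).  Abstract form PROVED (idea-9 `FluxPurity.twist_cost_le_of_pure_kernel`); what
is left is the Wilson-side discharge located in that file's header (slice twist map Haar-preserving & kernel-invariant; twisted time slicing).
Why it might fail: only if `twistedColdZ` is NOT `Tr(Ĉ 𝕋^t)` (a mis-placed stack) — checkable at strong coupling by cluster expansion.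
Sources: tHooft1979 (NPB 153) (2.14)–(2.20); Greensite2011 (4.44)–(4.45); idea-9 `Cruxes/IR/Lines/flux_purity_square_seam.lean`. -/
def PurityTwistBoundSU2 : Prop :=
  letI : MeasurableSpace (Matrix.specialUnitaryGroup (Fin 2) ℂ) := borel _
  haveI : BorelSpace (Matrix.specialUnitaryGroup (Fin 2) ℂ) := ⟨rfl⟩
  PurityTwistBoundAt (fundamentalLatticeRep 2) minusOneSU2 0

/-- **S1 IS A THEOREM (rev 5):** `PurityTwistBoundSU2` holds — `purityTwistBoundAt_of_central` at `G = SU(2)`, fundamental rep, `c = −1` (central), `μ = 0`. -/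
theorem purityTwistBoundSU2_holds : PurityTwistBoundSU2 := by
  letI : MeasurableSpace (Matrix.specialUnitaryGroup (Fin 2) ℂ) := borel _
  haveI : BorelSpace (Matrix.specialUnitaryGroup (Fin 2) ℂ) := ⟨rfl⟩
  exact purityTwistBoundAt_of_central (fundamentalLatticeRep 2) minusOneSU2_mem_center 0

/-- **STUB S2 `HeavyTwistSU2`** — the `ℤ₂` temporal twist of a FIXED `SU(2)` box becomes maximally expensive as `β → ∞`: `r_β(L) → 0` for
every `L ≥ 8` (magnetic free energy `F_mg → ∞`, electric flux free: the femto universe is the extreme deconfined regime).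
Why it might fail: it cannot if the Laplace count is right (twisted flat orbits isolated & rigid vs a 4-parameter abelian family: `r = O(β^{−3/2})`);
the honest risk is the SIZE of the lattice Hessian computation (non-degeneracy transverse to gauge orbits at the 4 twist-eaters).
Sources: deForcrandVonSmekal2002 (hep-lat/0107018) p.4; Luscher1983 (NPB 219, 233); vanBaalKoller1987 (Ann. Phys. 174, 299); tHooft1979. -/
def HeavyTwistSU2 : Prop :=
  letI : MeasurableSpace (Matrix.specialUnitaryGroup (Fin 2) ℂ) := borel _
  haveI : BorelSpace (Matrix.specialUnitaryGroup (Fin 2) ℂ) := ⟨rfl⟩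
  HeavyTwistAt (fundamentalLatticeRep 2) minusOneSU2 0

/-- **½-impurity of `SU(2)` boxes** — the one-twist weakening (`θ < 1/2`) of `FemtoWall.CentreFluxImpuritySU2` (`θ < 7/8`, all seven twists). -/
def HalfImpuritySU2 : Prop :=
  letI : MeasurableSpace (Matrix.specialUnitaryGroup (Fin 2) ℂ) := borel _
  haveI : BorelSpace (Matrix.specialUnitaryGroup (Fin 2) ℂ) := ⟨rfl⟩
  ∀ θ : ℝ, θ < 1 / 2 → EventualImpurityAt (fundamentalLatticeRep 2) θ

/-- **S1 ∧ S2 ⇒ ½-impurity** (PROVED). -/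
theorem halfImpuritySU2_of_twist (hB : PurityTwistBoundSU2) (hH : HeavyTwistSU2) : HalfImpuritySU2 := by
  letI : MeasurableSpace (Matrix.specialUnitaryGroup (Fin 2) ℂ) := borel _
  haveI : BorelSpace (Matrix.specialUnitaryGroup (Fin 2) ℂ) := ⟨rfl⟩
  intro θ hθ
  exact eventualImpurityAt_of_heavyTwist (fundamentalLatticeRep 2) hB hH hθ

/-- `UniformExitAt θ` — the seed `ColdExitAt θ` with `∃ L` / `∀ β` SWAPPED, on `E`'s own class. [verbatim `FemtoWall.UniformExitAt`] -/
def UniformExitAt (θ : ℝ) : Prop :=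
  ∀ (G : Type) [Group G] [TopologicalSpace G] [IsTopologicalGroup G] [CompactSpace G],
    IsCompactSimpleLieGroup G → SimplyConnectedSpace G →
    letI : MeasurableSpace G := borel G
    haveI : BorelSpace G := ⟨rfl⟩
    ∀ r : LatticeRep G, UniformExitAtRep r θ

/-- The β-uniform form at the tolerance of record. [verbatim `FemtoWall.UniformExit24`] -/
def UniformExit24 : Prop := UniformExitAt (1 / 24)

/-- `UniformExitAt θ` is a strengthening of the seed. [verbatim `FemtoWall.coldExitAt_of_uniformExitAt`] -/
theorem coldExitAt_of_uniformExitAt {θ : ℝ} (h : UniformExitAt θ) : ColdExitAt θ := by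
  intro G _ _ _ _ hG hsc
  letI : MeasurableSpace G := borel G
  haveI : BorelSpace G := ⟨rfl⟩
  intro r
  obtain ⟨L, hL, β₁, hβ₁⟩ := h G hG hsc r
  exact ⟨β₁, fun β hβ => ⟨L, hL, hβ₁ β hβ⟩⟩

/-- **The strengthening is refuted below tolerance ½ at `SU(2)`** (PROVED from ½-impurity and the binder fact `π₁(SU(2)) = 1`,
Bröcker–tom Dieck V (7.13), carried as a hypothesis as in `femto-wall`). -/
theorem not_uniformExitAt_of_halfImpurity (h : HalfImpuritySU2)
    (hsc : SimplyConnectedSpace (Matrix.specialUnitaryGroup (Fin 2) ℂ)) {θ : ℝ} (hθ : θ < 1 / 2) :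
    ¬ UniformExitAt θ := by
  intro hU
  have hG : IsCompactSimpleLieGroup (Matrix.specialUnitaryGroup (Fin 2) ℂ) :=
    isCompactSimpleLieGroup_specialUnitaryGroup isSimpleCompactGroup_specialUnitaryGroup_holds le_rfl
  letI : MeasurableSpace (Matrix.specialUnitaryGroup (Fin 2) ℂ) := borel _
  haveI : BorelSpace (Matrix.specialUnitaryGroup (Fin 2) ℂ) := ⟨rfl⟩
  have hUr : UniformExitAtRep (fundamentalLatticeRep 2) θ := hU _ hG hsc (fundamentalLatticeRep 2)
  exact not_uniformExitAtRep _ (h θ hθ) hUr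

/-- **Headline (PROVED modulo S1, S2, `π₁(SU(2)) = 1`): no β-uniform witness for the seed of record — `¬ UniformExit24`.** -/
theorem not_uniformExit24_of_twist (hB : PurityTwistBoundSU2) (hH : HeavyTwistSU2)
    (hsc : SimplyConnectedSpace (Matrix.specialUnitaryGroup (Fin 2) ℂ)) : ¬ UniformExit24 :=
  not_uniformExitAt_of_halfImpurity (halfImpuritySU2_of_twist hB hH) hsc (by norm_num)

/-! ## §5a S2-ONLY COROLLARIES (S1 is a theorem): the wall statements with only their physical hypothesis -/

/-- **S2 alone ⇒ ½-impurity of every fixed `SU(2)` box.** -/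
theorem halfImpuritySU2_of_heavyTwist (hH : HeavyTwistSU2) : HalfImpuritySU2 :=
  halfImpuritySU2_of_twist purityTwistBoundSU2_holds hH

/-- **S2 alone (+ `π₁(SU(2)) = 1` as hypothesis) refutes `UniformExitAt θ` for every `θ < 1/2`.** -/
theorem not_uniformExitAt_of_heavyTwistSU2 (hH : HeavyTwistSU2)
    (hsc : SimplyConnectedSpace (Matrix.specialUnitaryGroup (Fin 2) ℂ)) {θ : ℝ} (hθ : θ < 1 / 2) : ¬ UniformExitAt θ :=
  not_uniformExitAt_of_halfImpurity (halfImpuritySU2_of_heavyTwist hH) hsc hθ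

end Summit.QuantumFields.YangMills.Theorems.ColdExitSC.Negative.HeavyTwist
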